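import Literature.StrongHypotheses.ABC
import Literature.NumberTheory.DiophantineGeometry.AbcWave0UniformABCProofs
import HarnessLib

/-!
# The abc conjecture over every number field contains abc over `ℚ` (case `K = ℚ`)

`Literature.StrongHypotheses.ABC.NumberFieldABCConjecture` (Strong-Hypothesis Library of the summit
`ABC`, entry #9: for every number field `K` and `ε > 0` there is `C = C(K, ε)` with
`H_K(a : b : c) < C · N_K(a, b, c)^{1+ε}` for all nonzero `a + b = c` in `K`) is an OPEN conjecture and
not a dischargeable named fact. This companion file proves, sorry-free and without touching the
registry `Literature/StrongHypotheses/ABC.lean`, the printed remark that its case `K = ℚ` *is* the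
abc conjecture of Masser–Oesterlé — inside `Literature/`, which cannot import the summit `ABC` of
`Summits/ABC/ABC/Statement.lean`, this is stated as: `NumberFieldABCConjecture` implies, word for
word, the displayed sentence of `ABC` (`∀ ε > 0, ∃ C > 0`, every abc triple has
`c < C · rad(abc)^{1+ε}`), exactly as `UniformABCConjecture.abc_rat`
(`AbcWave0UniformABCProofs`) does for Granville–Stark's uniform conjecture (entry #6).

**Source.** Granville–Stark, Invent. Math. 139 (2000), §1, opening sentence: "Oesterlé and
Masser's abc-conjecture asserts that for any given `ε > 0`, if `a`, `b` and `c` are coprime positive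
integers satisfying `a + b = c` then `c ≪_ε N(a, b, c)^{1+ε}`, where `N(a, b, c)` is the product of
the distinct primes dividing `abc`" — the case `K = ℚ` of their number-field inequality (1)
`H(a, b, c) ≪_ε (Δ_K N(a, b, c))^{1+ε}` [cite: GranvilleStark2000, §1 (opening sentence) with eq. (1)];
Evertse–Győry, *Unit Equations in Diophantine Number Theory* (2015), §4.6: "For `K = ℚ`, this
reduces to the Oesterlé–Masser Conjecture" [cite: EvertseGyory2015, §4.6].

**Proof** (the printed remark made explicit = the proof of `UniformABCConjecture.abc_rat` with the
degree/discriminant factor absent). Specialise to `K := ℚ`, fix `ε > 0`, obtain `C`. For an abc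
triple `(a, b, c)` viewed in `ℚ` (nonzero, `a + b = c`): `H_ℚ(a : b : c) = c`
(`UniformABCConjecture.mulHeight_natCast_eq`, from Mathlib's `Rat.mulHeight_eq_max_abs_of_gcd_eq_one`)
and `N_ℚ(a, b, c) ≤ rad(abc)` (`UniformABCConjecture.radicalNorm_natCast_le_rad`), so
`c < C · N_ℚ^{1+ε} ≤ max C 1 · rad(abc)^{1+ε}` with `max C 1 > 0`.

* `NumberFieldABCConjecture.abc_rat` — the `K = ℚ` case, verbatim the body of `ABC`; the summit-side
  bridge `Summit.ABC.StrongHypotheses.NumberFieldABCConjectureImpliesABC` is then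
  `fun h => ABC_iff.mpr h.abc_rat` (cf. `Summit.ABC.StrongHypotheses.uniformABC_imp_abc`);
* `NumberFieldABCConjecture.not_abcNegation`, `NumberFieldABCConjecture.abcQualityForm` — the same
  through the equivalences of `AbcWave0QualityFormProofs` (abc.S02 negation flag, abc.S05 quality
  form);
* `UniformABCConjecture.numberFieldABCConjecture` — Granville–Stark's uniform conjecture (entry #6)
  implies the `K`-by-`K` conjecture (entry #9): at fixed `K` take
  `C(K, ε) := C^{[K:ℚ]} · |D_K|^{1+ε}` (the registry's remark "implied by `UniformABCConjecture`").

No new definitions, no named facts, no `sorry`, no axiom beyond the whitelist.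
-/

noncomputable section

open NumberField

namespace Literature.StrongHypotheses.ABC

open Literature.NumberTheory.DiophantineGeometry

/-- **`K = ℚ` of the number-field abc conjecture is the abc conjecture.** `NumberFieldABCConjecture`
implies the displayed sentence of the summit statement `ABC` — `∀ ε > 0, ∃ C > 0`, every abc triple
(coprime positive naturals `a + b = c`) has `c < C · rad(abc)^{1+ε}` (radical computed in `ℕ`,
`^` = `Real.rpow`) — by taking `K = ℚ`, where `H_ℚ(a : b : c) = c` and `N_ℚ(a, b, c) ≤ rad(abc)`, and
replacing the constant `C = C(ℚ, ε)` by `max C 1 > 0`. Granville–Stark, §1: Oesterlé–Masser's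
`c ≪_ε N(a, b, c)^{1+ε}` is the rational case of the number-field inequality (1).
[cite: GranvilleStark2000, §1 (opening sentence) with eq. (1)] [cite: EvertseGyory2015, §4.6] -/
theorem NumberFieldABCConjecture.abc_rat (h : NumberFieldABCConjecture) :
    ∀ ε : ℝ, 0 < ε → ∃ C : ℝ, 0 < C ∧
      ∀ a b c : ℕ, IsABCTriple a b c → (c : ℝ) < C * ((rad a b c : ℕ) : ℝ) ^ (1 + ε) := by
  intro ε hε
  obtain ⟨C, hC⟩ := h ℚ ε hε
  refine ⟨max C 1, lt_max_of_lt_right one_pos, fun a b c ht => ?_⟩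
  have ha : 0 < a := ht.1
  have hb : 0 < b := ht.2.1
  have hc : 0 < c := by have := ht.2.2.1; omega
  have habc : a * b * c ≠ 0 := by positivity
  have H := hC (a : ℚ) (b : ℚ) (c : ℚ) (by exact_mod_cast ha.ne') (by exact_mod_cast hb.ne')
    (by exact_mod_cast hc.ne') (by exact_mod_cast ht.2.2.1)
  have H' : (c : ℝ) < C * (radicalNorm (a : ℚ) (b : ℚ) (c : ℚ) : ℝ) ^ (1 + ε) :=
    lt_of_eq_of_lt (UniformABCConjecture.mulHeight_natCast_eq ht).symm H
  have hN : (radicalNorm (a : ℚ) (b : ℚ) (c : ℚ) : ℝ) ≤ ((rad a b c : ℕ) : ℝ) := by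
    exact_mod_cast UniformABCConjecture.radicalNorm_natCast_le_rad habc
  have hpow : (radicalNorm (a : ℚ) (b : ℚ) (c : ℚ) : ℝ) ^ (1 + ε) ≤
      ((rad a b c : ℕ) : ℝ) ^ (1 + ε) :=
    Real.rpow_le_rpow (Nat.cast_nonneg _) hN (by linarith)
  calc (c : ℝ) < C * (radicalNorm (a : ℚ) (b : ℚ) (c : ℚ) : ℝ) ^ (1 + ε) := H'
    _ ≤ max C 1 * (radicalNorm (a : ℚ) (b : ℚ) (c : ℚ) : ℝ) ^ (1 + ε) :=
      mul_le_mul_of_nonneg_right (le_max_left C 1) (by positivity)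
    _ ≤ max C 1 * ((rad a b c : ℕ) : ℝ) ^ (1 + ε) :=
      mul_le_mul_of_nonneg_left hpow (by positivity)

/-- **The number-field abc conjecture refutes the abc-neg flag**: `NumberFieldABCConjecture → ¬ ABCNegation`
(abc.S02), via `abc_rat` and `not_abcNegation_iff_forall_exists_const`.
[cite: GranvilleStark2000, §1 (opening sentence) with eq. (1)] -/
theorem NumberFieldABCConjecture.not_abcNegation (h : NumberFieldABCConjecture) : ¬ ABCNegation :=
  not_abcNegation_iff_forall_exists_const.2 h.abc_rat

/-- **The number-field abc conjecture implies the quality form of abc** (abc.S05: for every `ε > 0`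
only finitely many abc triples have quality `> 1 + ε`), via `abc_rat` and
`abcQualityForm_iff_forall_exists_const`. [cite: GranvilleStark2000, §1 (opening sentence) with eq. (1)] -/
theorem NumberFieldABCConjecture.abcQualityForm (h : NumberFieldABCConjecture) : ABCQualityForm :=
  abcQualityForm_iff_forall_exists_const.2 h.abc_rat

/-- **Uniform abc ⟹ abc over every number field**: Granville–Stark's uniform conjecture (1),
`H_K(a : b : c) < C^{[K:ℚ]} · (|D_K| · N_K(a, b, c))^{1+ε}` with one `C = C(ε)` for all number fields,
implies the `K`-by-`K` conjecture with `C(K, ε) := C^{[K:ℚ]} · |D_K|^{1+ε}`, since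
`(|D_K| · N)^{1+ε} = |D_K|^{1+ε} · N^{1+ε}` (`Real.mul_rpow`, both factors nonnegative) — the factor
`C^{[K:ℚ]} |D_K|^{1+ε}` "absorbed into a `K`-dependent constant" (docstring of
`NumberFieldABCConjecture`). [cite: GranvilleStark2000, §1 eq. (1)] -/
theorem _root_.Literature.NumberTheory.DiophantineGeometry.UniformABCConjecture.numberFieldABCConjecture
    (h : UniformABCConjecture) : NumberFieldABCConjecture := by
  intro K _ _ ε hε
  obtain ⟨C, hC⟩ := h ε hε
  refine ⟨C ^ Module.finrank ℚ K * (|NumberField.discr K| : ℝ) ^ (1 + ε), fun a b c ha hb hc habc => ?_⟩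
  have H := hC K a b c ha hb hc habc
  rwa [Real.mul_rpow (abs_nonneg _) (Nat.cast_nonneg _), ← mul_assoc] at H

end Literature.StrongHypotheses.ABC

end
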